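import Mathlib
import Literature.Probability.LatticeModels.TransferOperator

/-!
# Vacuum spectral lower bound `λ ^ k |⟪e, v⟫|² ≤ re ⟪v, T ^ k v⟫`
(crux `QuarksAsStableAction.StableActionBridge`, item stmt-QuantumFields-9737, line `Sketch`;
registered stub `vacuum_inner_pow_ge_eigen` of the lead skeleton)

Operator form of the finite-dimensional atom by which a light state refutes a uniform lattice
mass gap (Goldstone mechanism, clause `IsChiralAtZero`). For transfer data `(T, Ω)` on a complex
Hilbert space `H` (Lüscher's transfer matrix `T`, a positive contraction), if `T e = λ e` with
`‖e‖ = 1` and `λ : ℝ`, then for every vector `v` (think `v = B̂ Ω`) and every Euclidean time `k`,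

  `λ ^ k ‖⟪e, v⟫‖ ² ≤ re ⟪v, T ^ k v⟫`,

so the vacuum two-point function decays no faster than `λ ^ k |⟪e, v⟫|²`.

The proof is elementary (no spectral theorem): write `v = u + α e` with `α = ⟪e, v⟫` and
`⟪e, u⟫ = 0`; since `T ^ k e = λ ^ k e` and `T ^ k` is symmetric both cross terms vanish, the
`e`-term equals `λ ^ k |α|²`, and the `u`-term has nonnegative real part because `T ^ k` is a
positive operator (`T ^ (n + 2) = T ∘ T ^ n ∘ T†` with `T† = T`). Mathlib's inner product is
conjugate-linear in the first argument.
-/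

namespace Summit.QuantumFields.QCD.Cruxes.StableActionBridge.Sketch

open scoped InnerProductSpace ComplexOrder
open Literature.Probability.LatticeModels

section Helpers

variable {H : Type*} [NormedAddCommGroup H] [InnerProductSpace ℂ H] [CompleteSpace H]

/-- Powers of a positive operator are positive: `T ^ (n + 2) = T ∘ T ^ n ∘ T†` with `T† = T`,
and conjugation by `T` preserves positivity. [folklore] -/
private theorem isPositive_transfer_pow {T : H →L[ℂ] H} (hT : T.IsPositive) (L : ℕ) :
    (T ^ L).IsPositive := by
  suffices h : ∀ n : ℕ, (T ^ n).IsPositive ∧ (T ^ (n + 1)).IsPositive from (h L).1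
  intro n
  induction n with
  | zero =>
    refine ⟨?_, ?_⟩
    · rw [pow_zero]
      exact ContinuousLinearMap.isPositive_one
    · rw [zero_add, pow_one]
      exact hT
  | succ n ih =>
    refine ⟨ih.2, ?_⟩
    have h := ih.1.conj_adjoint T
    rw [hT.isSelfAdjoint.adjoint_eq, ← ContinuousLinearMap.mul_def,
      ← ContinuousLinearMap.mul_def, ← mul_assoc, ← pow_succ', ← pow_succ] at h
    exact h

omit [CompleteSpace H] in
/-- An eigenvector of `T` with eigenvalue `c` is an eigenvector of `T ^ k` with eigenvalue
`c ^ k`. [folklore] -/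
private theorem pow_apply_eq_pow_smul {T : H →L[ℂ] H} {e : H} {c : ℂ} (he : T e = c • e)
    (k : ℕ) : (T ^ k) e = (c ^ k) • e := by
  induction k with
  | zero => rw [pow_zero, pow_zero, one_apply_eq_self, one_smul]
  | succ k ih =>
    rw [pow_succ, mul_apply_eq_comp, he, map_smul, ih, smul_smul, ← pow_succ']

omit [CompleteSpace H] in
/-- Algebraic core of the spectral lower bound: for a symmetric `S` with `S e = μ e`,
`‖e‖ = 1`, and any `v`, splitting `v = u + α e` with `α = ⟪e, v⟫` (so `⟪e, u⟫ = 0`) gives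
`⟪v, S v⟫ = ⟪u, S u⟫ + μ |α|²` — the cross terms vanish. [folklore] -/
private theorem inner_apply_eigen_split {S : H →L[ℂ] H}
    (hS : ∀ x y : H, ⟪S x, y⟫_ℂ = ⟪x, S y⟫_ℂ) {e : H} {μ : ℂ} (hSe : S e = μ • e)
    (he : ‖e‖ = 1) (v : H) :
    ⟪v, S v⟫_ℂ =
      ⟪v - ⟪e, v⟫_ℂ • e, S (v - ⟪e, v⟫_ℂ • e)⟫_ℂ +
        μ * ((Complex.normSq ⟪e, v⟫_ℂ : ℝ) : ℂ) := by
  set α : ℂ := ⟪e, v⟫_ℂ with hα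
  set u : H := v - α • e with hu
  have hee : ⟪e, e⟫_ℂ = 1 := inner_self_eq_one_of_norm_eq_one he
  -- `u ⟂ e`
  have heu : ⟪e, u⟫_ℂ = 0 := by
    rw [hu, inner_sub_right, inner_smul_right, hee, mul_one, hα, sub_self]
  have hue : ⟪u, e⟫_ℂ = 0 := by rw [← inner_conj_symm, heu, map_zero]
  -- `S (α e) = (α μ) e`
  have hSw : S (α • e) = (α * μ) • e := by rw [map_smul, hSe, smul_smul]
  -- the two cross terms vanish
  have h1 : ⟪u, S (α • e)⟫_ℂ = 0 := by rw [hSw, inner_smul_right, hue, mul_zero]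
  have h2 : ⟪α • e, S u⟫_ℂ = 0 := by rw [← hS (α • e) u, hSw, inner_smul_left, heu, mul_zero]
  -- the `e`-term
  have h3 : ⟪α • e, S (α • e)⟫_ℂ = μ * ((Complex.normSq α : ℝ) : ℂ) := by
    rw [hSw, inner_smul_left, inner_smul_right, hee, mul_one, Complex.normSq_eq_conj_mul_self]
    ring
  have hv : v = u + α • e := by rw [hu, sub_add_cancel]
  calc ⟪v, S v⟫_ℂ = ⟪u + α • e, S (u + α • e)⟫_ℂ := by rw [← hv]
    _ = ⟪u, S u⟫_ℂ + ⟪u, S (α • e)⟫_ℂ + (⟪α • e, S u⟫_ℂ + ⟪α • e, S (α • e)⟫_ℂ) := by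
        rw [map_add, inner_add_left, inner_add_right, inner_add_right]
    _ = ⟪u, S u⟫_ℂ + μ * ((Complex.normSq α : ℝ) : ℂ) := by
        rw [h1, h2, h3, add_zero, zero_add]

end Helpers

/-- **Vacuum spectral lower bound** (Goldstone atom, clause `IsChiralAtZero`): for transfer
data `(T, Ω)` on a complex Hilbert space (`T` a positive contraction), a normalised eigenvector
`T e = λ e`, `‖e‖ = 1` with `λ : ℝ`, any `v : H` and any `k : ℕ`,
`λ ^ k ‖⟪e, v⟫‖ ² ≤ re ⟪v, T ^ k v⟫`: the two-point function `⟪v, T ^ k v⟫` decays no faster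
than `λ ^ k |⟪e, v⟫|²`. [folklore] -/
theorem vacuum_inner_pow_ge_eigen : ∀ (H : Type) [NormedAddCommGroup H] [InnerProductSpace ℂ H] [CompleteSpace H] (D : TransferData H) (e v : H) (lam : ℝ) (k : ℕ), D.T e = (lam : ℂ) • e → ‖e‖ = 1 → lam ^ k * ‖⟪e, v⟫_ℂ‖ ^ 2 ≤ (⟪v, (D.T ^ k) v⟫_ℂ).re := by
  intro H _ _ _ D e v lam k he hnorm
  have hTk : (D.T ^ k).IsPositive := isPositive_transfer_pow D.isPositive k
  have hTke : (D.T ^ k) e = ((lam : ℂ) ^ k) • e := pow_apply_eq_pow_smul he k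
  rw [inner_apply_eigen_split hTk.inner_left_eq_inner_right hTke hnorm v, Complex.add_re]
  have h0 : 0 ≤ (⟪v - ⟪e, v⟫_ℂ • e, (D.T ^ k) (v - ⟪e, v⟫_ℂ • e)⟫_ℂ).re :=
    hTk.re_inner_nonneg_right _
  have h1 : ((lam : ℂ) ^ k * ((Complex.normSq ⟪e, v⟫_ℂ : ℝ) : ℂ)).re =
      lam ^ k * ‖⟪e, v⟫_ℂ‖ ^ 2 := by
    rw [← Complex.ofReal_pow, ← Complex.ofReal_mul, Complex.ofReal_re, Complex.normSq_eq_norm_sq]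
  rw [h1]
  linarith

end Summit.QuantumFields.QCD.Cruxes.StableActionBridge.Sketch
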